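/-
Copyright (c) 2026. All rights reserved.
Released under Apache 2.0 license as described in the file LICENSE.
-/
import Summits.AtomisticToContinuum.Crystallization.Theorems.ContactSaturationLadderSparseRungs

/-!
# Contact-saturation ladder — the SPARSE RUNG THEOREMS, part 2 (§6 onward: rung 2 at `R = 7/5`, molecules, the pair bound)

Continuation of `ContactSaturationLadderSparseRungs` (lens-1 g36 file `ContactSaturationLadderSparseRungs.lean`, sha256 a2ade6105312f4bd…,
split at landing by hand-2 g10 under the gate's ≤ 400-line rule; same namespace, declarations byte-identical).
-/

namespace Summit.AtomisticToContinuum.Crystallization.Theorems.ContactSaturationLadderSparseRungs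

open scoped BigOperators Classical RealInnerProductSpace ENNReal
open Metric Module MeasureTheory
open Literature.MathematicalPhysics.StatisticalMechanics (card_le_of_separated_of_dist_le)
open Summit.AtomisticToContinuum.Crystallization.Theorems.PerronTransitivityUniformBindingRigidity (packing_mul_inv_pow_six_sub_le
  packing_mul_inv_pow_six_le)

variable {N : ℕ}

/-! ## §6 Rung 2 at `R = 7/5`: MOLECULES.  Two geometric lemmas -/

/-- A point of the far half-space of `a` (looking away from `b`) is at least as far from `b` as `a` is:
`r ≤ |a − b| ∧ 0 ≤ ⟪x − a, a − b⟫ ⟹ r ≤ |x − b|` (`|x − b|² = |x − a|² + 2⟪x − a, a − b⟫ + |a − b|²`). -/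
theorem le_dist_of_inner_nonneg {a b x : EuclideanSpace ℝ (Fin 3)} {r : ℝ} (hab : r ≤ dist a b)
    (hx : 0 ≤ ⟪x - a, a - b⟫) : r ≤ dist x b := by
  rw [dist_eq_norm] at hab ⊢
  have h : ‖x - b‖ ^ 2 = ‖x - a‖ ^ 2 + 2 * ⟪x - a, a - b⟫ + ‖a - b‖ ^ 2 := by
    rw [← norm_add_sq_real]
    congr 1
    abel_nf
  have h2 : ‖a - b‖ ^ 2 ≤ ‖x - b‖ ^ 2 := by nlinarith [norm_nonneg (x - a)]
  exact hab.trans ((pow_le_pow_iff_left₀ (norm_nonneg _) (norm_nonneg _) two_ne_zero).1 h2)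

/-- **Half-ball lemma.** A ball has at most twice the volume of each of its closed half-balls through the centre:
`vol B(c, ρ) ≤ 2 · vol (B(c, ρ) ∩ {⟪x − c, u⟫ ≥ 0})` — the point reflection `x ↦ 2c − x` preserves Lebesgue measure and swaps the
two half-balls. [folklore] -/
theorem volume_ball_le_two_mul_halfBall (c u : EuclideanSpace ℝ (Fin 3)) (ρ : ℝ) :
    volume (ball c ρ) ≤ 2 * volume (ball c ρ ∩ {x | 0 ≤ ⟪x - c, u⟫}) := by
  set Hp : Set (EuclideanSpace ℝ (Fin 3)) := {x | 0 ≤ ⟪x - c, u⟫} with hHp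
  set Hm : Set (EuclideanSpace ℝ (Fin 3)) := {x | ⟪x - c, u⟫ ≤ 0} with hHm
  have hcover : ball c ρ ⊆ (ball c ρ ∩ Hp) ∪ (ball c ρ ∩ Hm) := by
    intro x hx
    rcases le_total 0 ⟪x - c, u⟫ with h | h
    · exact Or.inl ⟨hx, h⟩
    · exact Or.inr ⟨hx, h⟩
  have hmeas : MeasurableSet (ball c ρ ∩ Hp) :=
    measurableSet_ball.inter
      (isClosed_le continuous_const ((continuous_id.sub continuous_const).inner continuous_const)).measurableSet
  set f : EuclideanSpace ℝ (Fin 3) → EuclideanSpace ℝ (Fin 3) := fun x => (c + c) + -x with hf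
  have hfmp : MeasurePreserving f volume volume :=
    (measurePreserving_add_left volume (c + c)).comp (Measure.measurePreserving_neg volume)
  have hpre : f ⁻¹' (ball c ρ ∩ Hp) = ball c ρ ∩ Hm := by
    ext x
    simp only [Set.mem_preimage, Set.mem_inter_iff, mem_ball, hHp, hHm, Set.mem_setOf_eq, hf]
    have e1 : dist (c + c + -x) c = dist x c := by
      rw [dist_eq_norm, dist_eq_norm, ← norm_neg (x - c)]
      congr 1
      abel_nf
    have e2 : ⟪c + c + -x - c, u⟫ = -⟪x - c, u⟫ := by
      rw [← inner_neg_left]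
      congr 1
      abel_nf
    rw [e1, e2, neg_nonneg]
  have heq : volume (ball c ρ ∩ Hm) = volume (ball c ρ ∩ Hp) := by
    rw [← hpre]
    exact hfmp.measure_preimage hmeas.nullMeasurableSet
  calc volume (ball c ρ) ≤ volume ((ball c ρ ∩ Hp) ∪ (ball c ρ ∩ Hm)) := measure_mono hcover
    _ ≤ volume (ball c ρ ∩ Hp) + volume (ball c ρ ∩ Hm) := measure_union_le _ _
    _ = 2 * volume (ball c ρ ∩ Hp) := by rw [heq, two_mul]

/-! ## §7 The paired packing count: `3·|T| ≤ 4·(t/r + 1)³` -/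

/-- **Paired packing count.** Let `y_i`, `i ∈ T`, be points of `B̄(p, t)` with hard core `r > 0` (`|y_i − y_j| ≥ r`) such that every
`y_i` has AT MOST ONE other `y_j` within distance `< 2r`.  Then `3|T| ≤ 4(t/r + 1)³` — a third better than the count `2(t/r+1)³` of two
interleaved `2r`-separated families.  Proof: orient each close pair `{i, j}` by the index order; the lower point keeps its ball
`B(y_j, r)`, the upper point the far HALF-ball `B(y_i, r) ∩ {⟪x − y_i, y_i − y_j⟫ ≥ 0}` (disjoint from `B(y_j, r)` by
`le_dist_of_inner_nonneg`); these regions are pairwise disjoint inside `B(p, t + r)`, the upper points inject into the lower ones,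
and a half-ball has half the volume (`volume_ball_le_two_mul_halfBall`), so the average credit is `≥ 3/4` of a ball. [new] -/
theorem card_le_paired (y : Fin N → EuclideanSpace ℝ (Fin 3)) (T : Finset (Fin N)) (p : EuclideanSpace ℝ (Fin 3)) {r t : ℝ}
    (hr : 0 < r) (ht : 0 ≤ t) (hin : ∀ i ∈ T, dist (y i) p ≤ t) (hsep : ∀ i ∈ T, ∀ j ∈ T, i ≠ j → r ≤ dist (y i) (y j))
    (hdeg : ∀ i ∈ T, ∀ j ∈ T, ∀ k ∈ T, j ≠ i → k ≠ i → j ≠ k → dist (y j) (y i) < 2 * r → 2 * r ≤ dist (y k) (y i)) :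
    3 * (T.card : ℝ) ≤ 4 * (t / r + 1) ^ 3 := by
  classical
  rcases T.eq_empty_or_nonempty with hT | ⟨i₀, _⟩
  · rw [hT, Finset.card_empty]
    simp only [Nat.cast_zero, mul_zero]
    positivity
  haveI : Nonempty (Fin N) := ⟨i₀⟩
  -- the lower-partner relation and the regions
  set low : Fin N → Fin N → Prop := fun i j => j ∈ T ∧ j < i ∧ dist (y j) (y i) < 2 * r with hlow
  set reg : Fin N → Set (EuclideanSpace ℝ (Fin 3)) := fun i =>
    ball (y i) r ∩ {x | ∀ j, low i j → 0 ≤ ⟪x - y i, y i - y j⟫} with hreg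
  -- at most one lower partner, and a lower partner has no lower partner and at most one upper partner
  have huniq : ∀ i ∈ T, ∀ j j', low i j → low i j' → j = j' := by
    intro i hi j j' hj hj'
    by_contra hne
    have := hdeg i hi j hj.1 j' hj'.1 (ne_of_lt hj.2.1) (ne_of_lt hj'.2.1) hne hj.2.2
    exact (not_lt.2 this) hj'.2.2
  -- measurability
  have hmeas : ∀ i, MeasurableSet (reg i) := by
    intro i
    refine measurableSet_ball.inter ?_
    have hset : {x : EuclideanSpace ℝ (Fin 3) | ∀ j, low i j → 0 ≤ ⟪x - y i, y i - y j⟫} =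
        ⋂ j, {x | low i j → 0 ≤ ⟪x - y i, y i - y j⟫} := by
      ext x
      simp only [Set.mem_setOf_eq, Set.mem_iInter]
    rw [hset]
    refine MeasurableSet.iInter fun j => ?_
    by_cases h : low i j
    · have : {x : EuclideanSpace ℝ (Fin 3) | low i j → 0 ≤ ⟪x - y i, y i - y j⟫} =
          {x | 0 ≤ ⟪x - y i, y i - y j⟫} := by
        ext x
        simp only [Set.mem_setOf_eq]
        exact ⟨fun hx => hx h, fun hx _ => hx⟩
      rw [this]
      exact (isClosed_le continuous_const ((continuous_id.sub continuous_const).inner continuous_const)).measurableSet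
    · have : {x : EuclideanSpace ℝ (Fin 3) | low i j → 0 ≤ ⟪x - y i, y i - y j⟫} = Set.univ := by
        ext x
        simp only [Set.mem_setOf_eq, Set.mem_univ, iff_true]
        exact fun hx => (h hx).elim
      rw [this]
      exact MeasurableSet.univ
  -- pairwise disjointness
  have hdisj : (T : Set (Fin N)).PairwiseDisjoint reg := by
    intro i hi j hj hij
    have hi : i ∈ T := hi
    have hj : j ∈ T := hj
    change Disjoint (reg i) (reg j)
    rcases le_or_gt (2 * r) (dist (y i) (y j)) with hfar | hnear
    · refine Disjoint.mono Set.inter_subset_left Set.inter_subset_left ?_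
      exact ball_disjoint_ball (by linarith)
    · rw [Set.disjoint_left]
      intro x hxi hxj
      rcases lt_or_gt_of_ne hij with hlt | hgt
      · -- `i < j`: `j` looks away from `i`
        have hx : 0 ≤ ⟪x - y j, y j - y i⟫ := hxj.2 i ⟨hi, hlt, hnear⟩
        have := le_dist_of_inner_nonneg (hsep j hj i hi (ne_of_gt hlt)) hx
        exact (not_lt.2 this) (mem_ball.1 hxi.1)
      · -- `j < i`: `i` looks away from `j`
        have hx : 0 ≤ ⟪x - y i, y i - y j⟫ := hxi.2 j ⟨hj, hgt, by rw [dist_comm]; exact hnear⟩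
        have := le_dist_of_inner_nonneg (hsep i hi j hj hij) hx
        exact (not_lt.2 this) (mem_ball.1 hxj.1)
  -- containment in the big ball
  have hsub : ∀ i ∈ T, reg i ⊆ ball p (t + r) := fun i hi =>
    Set.inter_subset_left.trans (ball_subset_ball' (by have := hin i hi; linarith))
  -- the two classes
  set H := T.filter fun i => ∃ j, low i j with hH
  set F := T.filter fun i => ¬ ∃ j, low i j with hF
  have hFH : H.card + F.card = T.card := Finset.card_filter_add_card_filter_not _
  have hpart : ∀ i ∈ H, ∃ j ∈ F, low i j := by
    intro i hi
    obtain ⟨hiT, j, hj⟩ := Finset.mem_filter.1 hi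
    refine ⟨j, Finset.mem_filter.2 ⟨hj.1, ?_⟩, hj⟩
    rintro ⟨k, hk⟩
    have hik : i ≠ k := fun h => by
      have := hk.2.1.trans hj.2.1
      rw [h] at this
      exact lt_irrefl _ this
    have h1 : dist (y i) (y j) < 2 * r := by rw [dist_comm]; exact hj.2.2
    have := hdeg j hj.1 i hiT k hk.1 (ne_of_gt hj.2.1) (ne_of_lt hk.2.1) hik h1
    exact (not_lt.2 this) hk.2.2
  choose! g hgF hg using hpart
  have hHF : H.card ≤ F.card := by
    refine Finset.card_le_card_of_injOn g hgF ?_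
    intro i hi i' hi' heq
    by_contra hne
    have h1 := hg i hi
    have h2 := hg i' hi'
    rw [heq] at h1
    have hiT : i ∈ T := (Finset.mem_filter.1 hi).1
    have hi'T : i' ∈ T := (Finset.mem_filter.1 hi').1
    have hd : dist (y i) (y (g i')) < 2 * r := by rw [dist_comm]; exact h1.2.2
    have := hdeg (g i') h2.1 i hiT i' hi'T (ne_of_gt h1.2.1) (ne_of_gt h2.2.1) hne hd
    rw [dist_comm] at this
    exact (not_lt.2 this) h2.2.2
  -- volumes of the regions
  have hvol_full : ∀ i ∈ F, volume (reg i) = volume (ball (y i) r) := by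
    intro i hi
    have hno := (Finset.mem_filter.1 hi).2
    have : reg i = ball (y i) r := by
      ext x
      simp only [hreg, Set.mem_inter_iff, Set.mem_setOf_eq, and_iff_left_iff_imp]
      exact fun _ j hj => (hno ⟨j, hj⟩).elim
    rw [this]
  have hvol_half : ∀ i ∈ H, volume (ball (y i) r) ≤ 2 * volume (reg i) := by
    intro i hi
    have hiT : i ∈ T := (Finset.mem_filter.1 hi).1
    have hl := hg i hi
    have hsubset : ball (y i) r ∩ {x | 0 ≤ ⟪x - y i, y i - y (g i)⟫} ⊆ reg i := by
      rintro x ⟨hxb, hx⟩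
      refine ⟨hxb, fun j hj => ?_⟩
      have : j = g i := huniq i hiT j (g i) hj hl
      rw [this]
      exact hx
    calc volume (ball (y i) r) ≤ 2 * volume (ball (y i) r ∩ {x | 0 ≤ ⟪x - y i, y i - y (g i)⟫}) :=
          volume_ball_le_two_mul_halfBall _ _ _
      _ ≤ 2 * volume (reg i) := by gcongr
  -- the unit volume and the scaled balls
  set V := volume (ball (0 : EuclideanSpace ℝ (Fin 3)) 1) with hV
  have hV0 : V ≠ 0 := (measure_ball_pos volume _ zero_lt_one).ne'
  have hVtop : V ≠ ⊤ := measure_ball_lt_top.ne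
  have hB : ∀ x : EuclideanSpace ℝ (Fin 3), volume (ball x r) = ENNReal.ofReal (r ^ 3) * V := by
    intro x
    have h := Measure.addHaar_ball_of_pos (volume : Measure (EuclideanSpace ℝ (Fin 3))) x hr
    rw [finrank_euclideanSpace_fin] at h
    exact h
  have htr : 0 < t + r := by linarith
  have hU : ∑ i ∈ T, volume (reg i) ≤ ENNReal.ofReal ((t + r) ^ 3) * V := by
    rw [← measure_biUnion_finset hdisj fun i _ => hmeas i]
    calc volume (⋃ i ∈ T, reg i) ≤ volume (ball p (t + r)) := measure_mono (Set.iUnion₂_subset hsub)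
      _ = ENNReal.ofReal ((t + r) ^ 3) * V := by
          have h := Measure.addHaar_ball_of_pos (volume : Measure (EuclideanSpace ℝ (Fin 3))) p htr
          rw [finrank_euclideanSpace_fin] at h
          exact h
  set X := ENNReal.ofReal (r ^ 3) * V with hX
  have hFsum : ∑ i ∈ F, volume (reg i) = (F.card : ℝ≥0∞) * X := by
    rw [Finset.sum_congr rfl fun i hi => (hvol_full i hi).trans (hB (y i)), Finset.sum_const, nsmul_eq_mul]
  have hHsum : (H.card : ℝ≥0∞) * X ≤ 2 * ∑ i ∈ H, volume (reg i) := by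
    rw [Finset.mul_sum]
    calc (H.card : ℝ≥0∞) * X = ∑ i ∈ H, volume (ball (y i) r) := by
          rw [Finset.sum_congr rfl fun i _ => hB (y i), Finset.sum_const, nsmul_eq_mul]
      _ ≤ ∑ i ∈ H, 2 * volume (reg i) := Finset.sum_le_sum fun i hi => hvol_half i hi
  have hsplit : ∑ i ∈ T, volume (reg i) = ∑ i ∈ H, volume (reg i) + ∑ i ∈ F, volume (reg i) :=
    (Finset.sum_filter_add_sum_filter_not T (fun i => ∃ j, low i j) _).symm
  have hnat : 3 * T.card ≤ 2 * H.card + 4 * F.card := by omega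
  have hL : ((3 * T.card : ℕ) : ℝ≥0∞) * X ≤ 4 * ∑ i ∈ T, volume (reg i) :=
    calc ((3 * T.card : ℕ) : ℝ≥0∞) * X ≤ ((2 * H.card + 4 * F.card : ℕ) : ℝ≥0∞) * X := by
          gcongr
      _ = 2 * ((H.card : ℝ≥0∞) * X) + 4 * ((F.card : ℝ≥0∞) * X) := by
          push_cast
          ring
      _ ≤ 2 * (2 * ∑ i ∈ H, volume (reg i)) + 4 * ∑ i ∈ F, volume (reg i) := by
          rw [← hFsum]
          gcongr
      _ = 4 * ∑ i ∈ T, volume (reg i) := by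
          rw [hsplit]
          ring
  -- cancel the unit volume and pass to the reals
  have key : ((3 * T.card : ℕ) : ℝ≥0∞) * ENNReal.ofReal (r ^ 3) ≤ 4 * ENNReal.ofReal ((t + r) ^ 3) := by
    have h4 : (4 : ℝ≥0∞) * ∑ i ∈ T, volume (reg i) ≤ 4 * (ENNReal.ofReal ((t + r) ^ 3) * V) := by gcongr
    have h := hL.trans h4
    rw [hX, ← mul_assoc, ← mul_assoc] at h
    exact (ENNReal.mul_le_mul_iff_left hV0 hVtop).1 h
  have key' : ((3 * T.card : ℕ) : ℝ) * r ^ 3 ≤ 4 * (t + r) ^ 3 := by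
    have hfin : (4 : ℝ≥0∞) * ENNReal.ofReal ((t + r) ^ 3) ≠ ⊤ :=
      ENNReal.mul_ne_top (by norm_num) ENNReal.ofReal_ne_top
    have h := ENNReal.toReal_mono hfin key
    rw [ENNReal.toReal_mul, ENNReal.toReal_mul, ENNReal.toReal_ofReal (by positivity),
      ENNReal.toReal_ofReal (by positivity)] at h
    simpa using h
  push_cast at key'
  have e : (t / r + 1) ^ 3 = (t + r) ^ 3 / r ^ 3 := by
    field_simp
  rw [e, mul_div_assoc', le_div_iff₀ (by positivity)]
  linarith

/-! ## §8 ★ RUNG 2 at `R = 7/5`: `S_{7/5}(2) ≤ (4/3)·T(7/5, 7/5) − (7/5)⁻⁶ = 2590625/352947 = 7.3400…` -/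

/-- `(4/3)·T(7/5, 7/5) − (7/5)⁻⁶ = 2590625/352947`. -/
theorem const_pair_seven_fifths :
    (4 / 3 : ℝ) * (16 / ((7 / 5 : ℝ) ^ 3 * (7 / 5) ^ 3) + 18 / ((7 / 5) ^ 2 * (7 / 5) ^ 4) +
        36 / (5 * (7 / 5) * (7 / 5) ^ 5) + 1 / (7 / 5) ^ 6) - (7 / 5 : ℝ)⁻¹ ^ 6 = 2590625 / 352947 := by
  norm_num

/-- **★ RUNG 2 IS A THEOREM: `S_{7/5}(2) ≤ 2590625/352947 = 7.3400`.** For an injective `7/10`-separated configuration, a finite index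
set `A` none of whose particles has `≥ 2` OTHER particles within distance `≤ 7/5` (the unmarked class of `coordMarkerR (7/5) 2 =
coordMarker 2`), and any `a`: `Σ_{b ∈ A∖a, |y_a − y_b| > 7/5} |y_a − y_b|⁻⁶ ≤ 2590625/352947` — the paired packing count (§7) fed into the
weighted Abel summation (§2) with `K = 4/3`, `δ = R = 7/5`, centre credit `1`.  [This is `SparseShellSumR (7/5) 2 (2590625/352947)`.] -/
theorem shellSum_two_le (y : Fin N → EuclideanSpace ℝ (Fin 3)) (hy : Function.Injective y)
    (hsep : ∀ i j : Fin N, i ≠ j → (7 : ℝ) / 10 ≤ dist (y i) (y j)) (A : Finset (Fin N))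
    (hA : ∀ b ∈ A, ¬ 2 ≤ (Finset.univ.filter fun l : Fin N => l ≠ b ∧ dist (y l) (y b) ≤ 7 / 5).card) {a : Fin N}
    (ha : a ∈ A) :
    ∑ b ∈ (A.erase a).filter (fun b => (7 : ℝ) / 5 < dist (y a) (y b)), (dist (y a) (y b))⁻¹ ^ 6 ≤ 2590625 / 352947 := by
  classical
  set B := (A.erase a).filter (fun b => (7 : ℝ) / 5 < dist (y a) (y b)) with hB
  set s : Finset (EuclideanSpace ℝ (Fin 3)) := B.image y with hs
  have hδ : (0 : ℝ) < 7 / 5 := by norm_num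
  have hsum : ∑ b ∈ B, (dist (y a) (y b))⁻¹ ^ 6 = ∑ q ∈ s, (dist q (y a))⁻¹ ^ 6 := by
    rw [hs, Finset.sum_image (fun b _ c _ h => hy h)]
    exact Finset.sum_congr rfl fun b _ => by rw [dist_comm]
  have hfar : ∀ q ∈ s, (7 : ℝ) / 5 ≤ dist q (y a) := by
    intro q hq
    obtain ⟨b, hb, rfl⟩ := Finset.mem_image.1 hq
    rw [dist_comm]
    exact le_of_lt (Finset.mem_filter.1 hb).2
  -- the degree condition of §7 on all of `A`
  have hdegA : ∀ i ∈ A, ∀ j k : Fin N, j ≠ i → k ≠ i → j ≠ k →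
      dist (y j) (y i) < 2 * (7 / 10) → 2 * (7 / 10) ≤ dist (y k) (y i) := by
    intro i hi j k hji hki hjk hj
    by_contra hk
    rw [not_le] at hk
    apply hA i hi
    have hsub : ({j, k} : Finset (Fin N)) ⊆ Finset.univ.filter fun l : Fin N => l ≠ i ∧ dist (y l) (y i) ≤ 7 / 5 := by
      intro l hl
      rw [Finset.mem_insert, Finset.mem_singleton] at hl
      rw [Finset.mem_filter]
      rcases hl with rfl | rfl
      · exact ⟨Finset.mem_univ _, hji, by linarith⟩
      · exact ⟨Finset.mem_univ _, hki, by linarith⟩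
    calc 2 = ({j, k} : Finset (Fin N)).card := (Finset.card_pair hjk).symm
      _ ≤ _ := Finset.card_le_card hsub
  have hcount : ∀ q ∈ s, ((1 : ℕ) : ℝ) + ((s.filter fun q' => dist q' (y a) ≤ dist q (y a)).card : ℝ) ≤
      (4 / 3 : ℝ) * (2 * dist q (y a) / (7 / 5) + 1) ^ 3 := by
    intro q hq
    set T : Finset (Fin N) := insert a (B.filter fun b => dist (y b) (y a) ≤ dist q (y a)) with hT
    have haB : a ∉ B.filter fun b => dist (y b) (y a) ≤ dist q (y a) := fun h =>
      (Finset.mem_erase.1 (Finset.mem_filter.1 (Finset.mem_filter.1 h).1).1).1 rfl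
    have hcardT : (T.card : ℝ) = 1 + ((s.filter fun q' => dist q' (y a) ≤ dist q (y a)).card : ℝ) := by
      rw [hT, Finset.card_insert_of_notMem haB, hs, Finset.filter_image,
        Finset.card_image_of_injective _ hy]
      push_cast
      ring
    have hTA : ∀ i ∈ T, i ∈ A := by
      intro i hi
      rcases Finset.mem_insert.1 hi with rfl | hi
      · exact ha
      · exact (Finset.mem_erase.1 (Finset.mem_filter.1 (Finset.mem_filter.1 hi).1).1).2
    have hin : ∀ i ∈ T, dist (y i) (y a) ≤ dist q (y a) := by
      intro i hi
      rcases Finset.mem_insert.1 hi with rfl | hi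
      · rw [dist_self]; exact dist_nonneg
      · exact (Finset.mem_filter.1 hi).2
    have h := card_le_paired y T (y a) (r := 7 / 10) (by norm_num) dist_nonneg hin
      (fun i _ j _ hij => hsep i j hij) (fun i hi j _ k _ => hdegA i (hTA i hi) j k)
    rw [hcardT] at h
    have e : dist q (y a) / (7 / 10) = 2 * dist q (y a) / (7 / 5) := by ring
    rw [e] at h
    push_cast
    linarith
  have hmain := sum_inv_pow_six_le_abelK hδ (by norm_num : (0 : ℝ) ≤ 4 / 3) (y a) s.card s 1 (7 / 5) rfl hδ
    (by norm_num) hfar hcount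
  rw [hsum]
  have hT := const_pair_seven_fifths
  simp only [Nat.cast_one, one_mul] at hmain
  linarith

/-- **Rung-2 threshold at the certified grade `γ = 5/7`:** `(2 − 1)/24 + (2590625/352947)/12 < 5/7` (`0.6533 < 0.7143`, margin `0.061`;
it FAILS at `γ = 1/2`).  With the lens node's `sparse_of_sparseShellSum` and `competitor_grade` this closes `SPARSE(2; δ)` for every `δ`
and, by `sparseTwo_of_sparse`, `SPARSE₂(2)`. -/
theorem threshold_pair_seven_fifths : ((2 : ℝ) - 1) / 24 + (2590625 / 352947 : ℝ) / 12 < 5 / 7 := by norm_num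

end Summit.AtomisticToContinuum.Crystallization.Theorems.ContactSaturationLadderSparseRungs
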